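import Literature.NumberTheory.LFunctions.Zhang2022.DetectorEntangledCone

/-!
# Zhang (2022), programme F-S3 (cell landau-siegel §E, row E-102 hygiene): the confluent recipe moments are
# CONTINUOUS in the shift triple (Hermite–Genocchi form of `Det.dd2`), hence the cone row `Det.EdetCone` is
# stable under CLOSURE of the anchor set and of the shift box — «PSD on a dense set of palettes ⇒ PSD on all»

Y. Zhang, *Discrete mean estimates and the Landau–Siegel zero*, arXiv:2211.02515v1 [Zhang2022LandauSiegel] —
an unrefereed manuscript under adjudication. **WHAT THIS IS NOT: not a claim about Theorems 1–2 of
arXiv:2211.02515, about Landau–Siegel zeros, about a repaired `Margin232`, or about Parity; nothing here asserts the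
row E-102 (`Det.EdetCone`, `Det.EdetPremise`) or any member of it. The programme SEARCHES and TYPES; no claim about
Landau–Siegel zeros, Theorems 1–2 of arXiv:2211.02515 or a repaired Margin232 until a kernel theorem says so.**

The B-det word of record (director-frontier 2026-08-26T23:09:45Z, §1a re-said 23:27:01Z, REF-B1 (w1″) 23:55:40Z) is
«KILL(B-det) INSIDE DET … GIVEN det-E15 E-det-cone (E-102) on the continuum»; E-102's head 1 is
`Det.EdetCone (Set.Ioo 0 1) (Set.Ioo 0 5)` (`DetectorEntangledCone`, p473997): for every anchor `a ∈ (0,1)` and every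
finite palette `b : Fin K → (0,5)` the block form `Re Σ_j Σ_l P^{dd}_{(a,b_j,b_l)}(h_j,h_l)` is `≥ 0` on one-sided kinked
profile vectors. The cell's discharge packet (B-det/plan/E102-DISCHARGE.md v1.3, §4 LINE C) uses in prose: «by
continuity of the kernel in (x,y) (divided differences of smooth functions are continuous incl. confluence) PSD on all
finite subsets of a DENSE palette set implies PSD on all finite palettes». THIS FILE makes that sentence a kernel
theorem (and nothing more — it is hygiene for LINE C / the member ladder, not a discharge):

* Part 1 `hg1`/`hg2` — the Hermite–Genocchi (segment / simplex integral) forms of the first two divided differences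
  of a globally `C²` function `ℝ → ℂ`; `dd2_eq_hg2` — the tree's casewise confluent `Det.dd2` IS the simplex integral
  (all five coincidence patterns), hence needs no case analysis downstream;
* Part 2 `hasDerivAt_ddBase`, `hasDerivAt_ddBase'`, `continuous_ddBase''₂` — the node functions `x^k e^{iπ(B−x)}`
  are `C²` with the derivative data `ddBase'`, `ddBase''` the tree supplies, jointly continuously in `(B, x)`;
* Part 3 `continuous_ddOf`, `continuous_ddM0` … `continuous_ddMbn`, `continuous_formDetPolarDD`,
  `continuous_entangledMain` — the six confluent moments, the block entries and the block form are continuous in the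
  triple / in `(a, b) ∈ ℝ × (Fin K → ℝ)` for fixed profiles;
* Part 4 `isClosed_setOf_conePSD`, `EdetCone.of_closure` (`EdetCone A B → EdetCone (closure A) (closure B)`),
  `edetCone_unit_of_dense` (a dense-in-`(0,1)` anchor set and a dense-in-`(0,5)` shift set suffice for head 1), and
  the monomial (head-2) analogue on the distinct-node locus `formDetPSD_of_closure`, the fixed-anchor forms
  `conePSD_of_closure` / `conePSD_of_dense` (E102-DISCHARGE v1.4 piece A3's name);
* Part 5 `continuous_formDetPolarDD_nodes`, `dense_setOf_pairwise_ne`, `eq_of_eqOn_pairwise_ne` — block level: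
  an identity of continuous functions of the node pair proved at pairwise-distinct `(a, x, y)` holds at confluent
  nodes too (the extension step of E102-DISCHARGE v1.4 LINE A's RE-CUT, target side).

Elementary real analysis (fundamental theorem of calculus, integration by parts, continuity of parametric interval
integrals); standard axioms; 0 named facts. Cell landau-siegel, ls-Bmulti-typer-2 g3 (AVAILABLE line
2026-08-27T00:34:08Z option (4)).

References: Y. Zhang, arXiv:2211.02515v1 (2022), proof of Prop. 7.1 (7.19)–(7.21) (the residue weights at repeated
shifts), §8 (8.11)–(8.23) [pp. 44–50]; C. de Boor, *Divided differences*, Surv. Approx. Theory 1 (2005) 46–69 = arXiv:math/0502036, §Genocchi–Hermite and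
§Continuity and smoothness [deBoor2005DividedDifferences]. [cite: Zhang2022LandauSiegel, §7 Prop. 7.1 (7.19)–(7.21), §8 (8.11)–(8.23)]
-/

noncomputable section

open Complex Real Set intervalIntegral Filter Topology
open _root_.MeasureTheory

namespace Literature.NumberTheory.LFunctions.Zhang2022

open Repair

namespace Det

/-! ### Part 1 — Hermite–Genocchi forms of the first two divided differences (complex-valued, global `C²`) -/

section HermiteGenocchi

variable {h h' h'' : ℝ → ℂ}

/-- **First divided difference, Hermite–Genocchi (segment) form**: `D₁(u,v) = ∫₀¹ h′(u + s(v−u)) ds`.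
[cite: deBoor2005DividedDifferences, §Genocchi–Hermite (univariate Genocchi–Hermite formula, n = 1, 2)] -/
def hg1 (h' : ℝ → ℂ) (u v : ℝ) : ℂ := ∫ s in (0:ℝ)..1, h' (u + s * (v - u))

/-- **Second divided difference, Hermite–Genocchi (simplex) form**:
`D₂(u,v,w) = ∫₀¹∫₀¹ s·h″(u + s(v−u) + sρ(w−v)) dρ ds` (the simplex integral `∫_{[u,v,w]} h″` in the coordinates
`(1−s, s(1−ρ), sρ)`). [cite: deBoor2005DividedDifferences, §Genocchi–Hermite (univariate Genocchi–Hermite formula, n = 1, 2)] -/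
def hg2 (h'' : ℝ → ℂ) (u v w : ℝ) : ℂ :=
  ∫ s in (0:ℝ)..1, ∫ ρ in (0:ℝ)..1, (s : ℂ) * h'' (u + s * (v - u) + s * ρ * (w - v))

/-- Chain rule along an affine reparametrisation `s ↦ c + s·d` for a complex-valued function. [folklore] -/
private theorem hasDerivAt_comp_affine {f f' : ℝ → ℂ} (hf : ∀ x, HasDerivAt f (f' x) x) (c d s : ℝ) :
    HasDerivAt (fun s : ℝ => f (c + s * d)) (f' (c + s * d) * (d : ℂ)) s := by
  have h1 : HasDerivAt (fun s : ℝ => c + s * d) d s := by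
    simpa using ((hasDerivAt_id s).mul_const d).const_add c
  have := (hf (c + s * d)).scomp s h1
  simpa [Function.comp_def, Complex.real_smul, mul_comm] using this

/-- `D₁(u,v)·(v − u) = h(v) − h(u)`. [cite: deBoor2005DividedDifferences, §Genocchi–Hermite (univariate Genocchi–Hermite formula, n = 1, 2)] -/
theorem hg1_mul_sub (hh : ∀ x, HasDerivAt h (h' x) x) (hc : Continuous h') (u v : ℝ) :
    hg1 h' u v * ((v - u : ℝ) : ℂ) = h v - h u := by
  have hderiv : ∀ s ∈ uIcc (0:ℝ) 1,
      HasDerivAt (fun s : ℝ => h (u + s * (v - u))) (h' (u + s * (v - u)) * ((v - u : ℝ) : ℂ)) s :=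
    fun s _ => hasDerivAt_comp_affine hh u (v - u) s
  have hint : IntervalIntegrable (fun s : ℝ => h' (u + s * (v - u)) * ((v - u : ℝ) : ℂ)) volume 0 1 :=
    ((hc.comp (by fun_prop)).mul continuous_const).intervalIntegrable _ _
  have hI := intervalIntegral.integral_eq_sub_of_hasDerivAt hderiv hint
  simp only [zero_mul, add_zero, one_mul, add_sub_cancel] at hI
  rw [hg1, ← hI, intervalIntegral.integral_mul_const]

/-- `D₁(u,u) = h′(u)`. [cite: deBoor2005DividedDifferences, §Genocchi–Hermite (univariate Genocchi–Hermite formula, n = 1, 2)] -/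
theorem hg1_self (h' : ℝ → ℂ) (u : ℝ) : hg1 h' u u = h' u := by
  simp [hg1]

/-- At distinct nodes `D₁(u,v) = (h v − h u)/(v − u)`. [cite: deBoor2005DividedDifferences, §Genocchi–Hermite (univariate Genocchi–Hermite formula, n = 1, 2)] -/
theorem hg1_of_ne (hh : ∀ x, HasDerivAt h (h' x) x) (hc : Continuous h') {u v : ℝ} (huv : u ≠ v) :
    hg1 h' u v = (h v - h u) / ((v - u : ℝ) : ℂ) := by
  have hne : ((v - u : ℝ) : ℂ) ≠ 0 := by exact_mod_cast sub_ne_zero.2 (Ne.symm huv)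
  rw [eq_div_iff hne, hg1_mul_sub hh hc]

/-- The inner (fundamental-theorem) step of the second form: for each `s`,
`(∫₀¹ s·h″(u + s(v−u) + sρ(w−v)) dρ)·(w − v) = h′(u + s(w−u)) − h′(u + s(v−u))`.
[cite: deBoor2005DividedDifferences, §Genocchi–Hermite (univariate Genocchi–Hermite formula, n = 1, 2)] -/
theorem hg2_inner_mul_sub (hh' : ∀ x, HasDerivAt h' (h'' x) x) (hc : Continuous h'') (u v w s : ℝ) :
    (∫ ρ in (0:ℝ)..1, (s : ℂ) * h'' (u + s * (v - u) + s * ρ * (w - v))) * ((w - v : ℝ) : ℂ)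
      = h' (u + s * (w - u)) - h' (u + s * (v - u)) := by
  have hderiv : ∀ ρ ∈ uIcc (0:ℝ) 1,
      HasDerivAt (fun ρ : ℝ => h' (u + s * (v - u) + ρ * (s * (w - v))))
        (h'' (u + s * (v - u) + ρ * (s * (w - v))) * ((s * (w - v) : ℝ) : ℂ)) ρ :=
    fun ρ _ => hasDerivAt_comp_affine hh' (u + s * (v - u)) (s * (w - v)) ρ
  have hint : IntervalIntegrable
      (fun ρ : ℝ => h'' (u + s * (v - u) + ρ * (s * (w - v))) * ((s * (w - v) : ℝ) : ℂ)) volume 0 1 :=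
    ((hc.comp (by fun_prop)).mul continuous_const).intervalIntegrable _ _
  have hI := intervalIntegral.integral_eq_sub_of_hasDerivAt hderiv hint
  have e1 : u + s * (v - u) + 1 * (s * (w - v)) = u + s * (w - u) := by ring
  simp only [zero_mul, add_zero, e1] at hI
  rw [← hI, ← intervalIntegral.integral_mul_const]
  refine intervalIntegral.integral_congr fun ρ _ => ?_
  have e2 : u + s * (v - u) + s * ρ * (w - v) = u + s * (v - u) + ρ * (s * (w - v)) := by ring
  simp only [e2]
  push_cast
  ring

/-- The inner integral is continuous in `s` (for the outer integration). [folklore] -/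
private theorem continuous_hg2_inner (hc : Continuous h'') (u v w : ℝ) :
    Continuous fun s : ℝ => ∫ ρ in (0:ℝ)..1, (s : ℂ) * h'' (u + s * (v - u) + s * ρ * (w - v)) := by
  refine intervalIntegral.continuous_parametric_intervalIntegral_of_continuous' ?_ 0 1
  exact (Complex.continuous_ofReal.comp continuous_fst).mul (hc.comp (by fun_prop))

/-- **`D₂(u,v,w)·(w − v) = D₁(u,w) − D₁(u,v)`** (no distinctness assumption). [cite: deBoor2005DividedDifferences, §Genocchi–Hermite (univariate Genocchi–Hermite formula, n = 1, 2)] -/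
theorem hg2_mul_sub (hh' : ∀ x, HasDerivAt h' (h'' x) x) (hc : Continuous h'') (u v w : ℝ) :
    hg2 h'' u v w * ((w - v : ℝ) : ℂ) = hg1 h' u w - hg1 h' u v := by
  rw [hg2, hg1, hg1, ← intervalIntegral.integral_mul_const]
  have hint1 : IntervalIntegrable (fun s : ℝ => h' (u + s * (w - u))) volume 0 1 := by
    have : Continuous h' := continuous_iff_continuousAt.2 fun x => (hh' x).continuousAt
    exact (this.comp (by fun_prop)).intervalIntegrable _ _
  have hint2 : IntervalIntegrable (fun s : ℝ => h' (u + s * (v - u))) volume 0 1 := by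
    have : Continuous h' := continuous_iff_continuousAt.2 fun x => (hh' x).continuousAt
    exact (this.comp (by fun_prop)).intervalIntegrable _ _
  rw [← intervalIntegral.integral_sub hint1 hint2]
  exact intervalIntegral.integral_congr fun s _ => hg2_inner_mul_sub hh' hc u v w s

/-- **The doubly confluent value**: `D₂(u,v,v) = ∫₀¹ s·h″(u + s(v−u)) ds`. [cite: deBoor2005DividedDifferences, §Genocchi–Hermite (univariate Genocchi–Hermite formula, n = 1, 2)] -/
theorem hg2_right_confluent (h'' : ℝ → ℂ) (u v : ℝ) :
    hg2 h'' u v v = ∫ s in (0:ℝ)..1, (s : ℂ) * h'' (u + s * (v - u)) := by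
  rw [hg2]
  refine intervalIntegral.integral_congr fun s _ => ?_
  simp

/-- Integration by parts: `(∫₀¹ s·h″(u + s(v−u)) ds)·(v − u) = h′(v) − D₁(u,v)`. [cite: deBoor2005DividedDifferences, §Genocchi–Hermite (univariate Genocchi–Hermite formula, n = 1, 2)] -/
theorem integral_smul_deriv2_mul_sub (hh' : ∀ x, HasDerivAt h' (h'' x) x) (hc : Continuous h'') (u v : ℝ) :
    (∫ s in (0:ℝ)..1, (s : ℂ) * h'' (u + s * (v - u))) * ((v - u : ℝ) : ℂ) = h' v - hg1 h' u v := by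
  -- ∫₀¹ s·φ′(s) ds = 1·φ(1) − 0·φ(0) − ∫₀¹ φ, φ(s) = h′(u + s(v−u)), φ′ = h″(…)(v−u)
  have hφ : ∀ s ∈ uIcc (0:ℝ) 1,
      HasDerivAt (fun s : ℝ => h' (u + s * (v - u))) (h'' (u + s * (v - u)) * ((v - u : ℝ) : ℂ)) s :=
    fun s _ => hasDerivAt_comp_affine hh' u (v - u) s
  have hid : ∀ s ∈ uIcc (0:ℝ) 1, HasDerivAt (fun s : ℝ => (s : ℂ)) 1 s :=
    fun s _ => by simpa using (hasDerivAt_id s).ofReal_comp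
  have hc' : Continuous h' := continuous_iff_continuousAt.2 fun x => (hh' x).continuousAt
  have hiφ' : IntervalIntegrable (fun s : ℝ => h'' (u + s * (v - u)) * ((v - u : ℝ) : ℂ)) volume 0 1 :=
    ((hc.comp (by fun_prop)).mul continuous_const).intervalIntegrable _ _
  have hi1 : IntervalIntegrable (fun _ : ℝ => (1 : ℂ)) volume 0 1 := intervalIntegrable_const
  have ibp := intervalIntegral.integral_mul_deriv_eq_deriv_mul hid hφ hi1 hiφ'
  -- ibp : ∫ s * (h''(…) * (v-u)) = 1 * h'(v) - 0 * h'(u) - ∫ 1 * h'(u + s (v-u))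
  simp only [Complex.ofReal_one, Complex.ofReal_zero, one_mul, zero_mul, sub_zero, add_zero] at ibp
  have e1 : u + (v - u) = v := by ring
  rw [e1] at ibp
  rw [← intervalIntegral.integral_mul_const, hg1]
  have : (fun s : ℝ => (s : ℂ) * h'' (u + s * (v - u)) * ((v - u : ℝ) : ℂ))
      = fun s : ℝ => (s : ℂ) * (h'' (u + s * (v - u)) * ((v - u : ℝ) : ℂ)) := by
    funext s; ring
  rw [this, ibp]

/-- `D₂(u,u,u) = h″(u)/2`. [cite: deBoor2005DividedDifferences, §Genocchi–Hermite (univariate Genocchi–Hermite formula, n = 1, 2)] -/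
theorem hg2_self (h'' : ℝ → ℂ) (u : ℝ) : hg2 h'' u u u = h'' u / 2 := by
  rw [hg2_right_confluent]
  simp only [sub_self, mul_zero, add_zero]
  rw [intervalIntegral.integral_mul_const, intervalIntegral.integral_ofReal, integral_id]
  push_cast
  ring

/-- **The tree's casewise confluent `Det.dd2` IS the Hermite–Genocchi simplex integral** (all coincidence
patterns), for a globally `C²` node function. [cite: deBoor2005DividedDifferences, §Genocchi–Hermite (univariate Genocchi–Hermite formula, n = 1, 2)] -/
theorem dd2_eq_hg2 (hh : ∀ x, HasDerivAt h (h' x) x) (hh' : ∀ x, HasDerivAt h' (h'' x) x)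
    (hc : Continuous h'') (x y z : ℝ) : dd2 h h' h'' x y z = hg2 h'' x y z := by
  have hc' : Continuous h' := continuous_iff_continuousAt.2 fun t => (hh' t).continuousAt
  have key := hg2_mul_sub hh' hc x y z          -- D₂(x,y,z)(z−y) = D₁(x,z) − D₁(x,y)
  unfold dd2
  split_ifs with h1 h2 h3 h4
  · -- pairwise distinct
    obtain ⟨hxy, hyz, hxz⟩ := h1
    rw [hg1_of_ne hh hc' hxz, hg1_of_ne hh hc' hxy] at key
    have hzy : ((z - y : ℝ) : ℂ) ≠ 0 := by exact_mod_cast sub_ne_zero.2 (Ne.symm hyz)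
    have c1 : (z : ℂ) - y ≠ 0 := by exact_mod_cast sub_ne_zero.2 (Ne.symm hyz)
    have c2 : (z : ℂ) - x ≠ 0 := by exact_mod_cast sub_ne_zero.2 (Ne.symm hxz)
    have c3 : (y : ℂ) - x ≠ 0 := by exact_mod_cast sub_ne_zero.2 (Ne.symm hxy)
    have c4 : (x : ℂ) - y ≠ 0 := by exact_mod_cast sub_ne_zero.2 hxy
    have c5 : (x : ℂ) - z ≠ 0 := by exact_mod_cast sub_ne_zero.2 hxz
    have c6 : (y : ℂ) - z ≠ 0 := by exact_mod_cast sub_ne_zero.2 hyz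
    rw [eq_div_of_mul_eq hzy key]
    push_cast
    field_simp
    ring
  · -- x = y = z
    obtain ⟨rfl, rfl⟩ := h2
    rw [hg2_self]
  · -- x = y ≠ z
    subst h3
    have hxz : x ≠ z := fun hxz => h2 ⟨rfl, hxz⟩
    rw [hg1_of_ne hh hc' hxz, hg1_self] at key
    have hzx : ((z - x : ℝ) : ℂ) ≠ 0 := by exact_mod_cast sub_ne_zero.2 (Ne.symm hxz)
    rw [eq_div_of_mul_eq hzx key]
  · -- y = z, x ≠ y
    subst h4
    have hxy : x ≠ y := h3
    have key2 := integral_smul_deriv2_mul_sub hh' hc x y   -- (∫ s h'')(y−x) = h' y − D₁(x,y)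
    rw [hg1_of_ne hh hc' hxy] at key2
    have hyx : ((y - x : ℝ) : ℂ) ≠ 0 := by exact_mod_cast sub_ne_zero.2 (Ne.symm hxy)
    have c3 : (y : ℂ) - x ≠ 0 := by exact_mod_cast sub_ne_zero.2 (Ne.symm hxy)
    have c4 : (x : ℂ) - y ≠ 0 := by exact_mod_cast sub_ne_zero.2 hxy
    rw [hg2_right_confluent, eq_div_of_mul_eq hyx key2]
    push_cast
    field_simp
    ring
  · -- remaining: x = z ≠ y (x ≠ y, y ≠ z)
    have hxy : x ≠ y := h3
    have hyz : y ≠ z := h4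
    have hxz : x = z := by
      by_contra hxz
      exact h1 ⟨hxy, hyz, hxz⟩
    subst hxz
    -- key : D₂(x,y,x)(x − y) = D₁(x,x) − D₁(x,y) = h' x − (h y − h x)/(y−x)
    rw [hg1_self, hg1_of_ne hh hc' hxy] at key
    have hxy' : ((x - y : ℝ) : ℂ) ≠ 0 := by exact_mod_cast sub_ne_zero.2 hxy
    have c3 : (y : ℂ) - x ≠ 0 := by exact_mod_cast sub_ne_zero.2 (Ne.symm hxy)
    have c4 : (x : ℂ) - y ≠ 0 := by exact_mod_cast sub_ne_zero.2 hxy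
    rw [eq_div_of_mul_eq hxy' key]
    push_cast
    field_simp
    ring

/-- **Joint continuity of the simplex form in a parameter and the three nodes**: if `F : P × ℝ → ℂ` is continuous
then `(p, x, y, z) ↦ ∫₀¹∫₀¹ s·F(p, x + s(y−x) + sρ(z−y)) dρ ds` is continuous.
[cite: deBoor2005DividedDifferences, §Continuity and smoothness, Proposition (continuity of the divided difference in its sites)] -/
theorem continuous_hg2_param {P : Type*} [TopologicalSpace P] {F : P → ℝ → ℂ}
    (hF : Continuous (Function.uncurry F)) :
    Continuous fun q : P × ℝ × ℝ × ℝ =>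
      hg2 (F q.1) q.2.1 q.2.2.1 q.2.2.2 := by
  unfold hg2
  -- the point of evaluation as a continuous function of ((q, s), ρ)
  have harg : Continuous fun w : ((P × ℝ × ℝ × ℝ) × ℝ) × ℝ =>
      (w.1.1.1, w.1.1.2.1 + w.1.2 * (w.1.1.2.2.1 - w.1.1.2.1) + w.1.2 * w.2 * (w.1.1.2.2.2 - w.1.1.2.2.1)) := by
    refine Continuous.prodMk (continuous_fst.comp (continuous_fst.comp continuous_fst)) ?_
    fun_prop
  have hs : Continuous fun w : ((P × ℝ × ℝ × ℝ) × ℝ) × ℝ => ((w.1.2 : ℝ) : ℂ) :=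
    Complex.continuous_ofReal.comp (continuous_snd.comp continuous_fst)
  -- the integrand, uncurried
  have hinner : Continuous (Function.uncurry fun (qs : (P × ℝ × ℝ × ℝ) × ℝ) (ρ : ℝ) =>
      (qs.2 : ℂ) * F qs.1.1 (qs.1.2.1 + qs.2 * (qs.1.2.2.1 - qs.1.2.1) + qs.2 * ρ * (qs.1.2.2.2 - qs.1.2.2.1))) :=
    (hs.mul (hF.comp harg)).congr fun _ => rfl
  have h1 := intervalIntegral.continuous_parametric_intervalIntegral_of_continuous' (μ := volume) hinner 0 1
  -- h1 : Continuous fun qs => ∫ ρ in 0..1, …  — read it as an uncurried function of (q, s)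
  have h2 : Continuous (Function.uncurry fun (q : P × ℝ × ℝ × ℝ) (s : ℝ) => ∫ ρ in (0:ℝ)..1,
      (s : ℂ) * F q.1 (q.2.1 + s * (q.2.2.1 - q.2.1) + s * ρ * (q.2.2.2 - q.2.2.1))) :=
    h1.congr fun _ => rfl
  exact intervalIntegral.continuous_parametric_intervalIntegral_of_continuous' h2 0 1

end HermiteGenocchi

/-! ### Part 2 — the node functions `x^k e^{iπ(B−x)}` are globally `C²` with the tree's derivative data -/

section NodeFunctions

/-- `((k − 1 : ℕ) : ℂ)·k = k(k − 1)` (also at `k = 0`). [folklore] -/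
private theorem natCast_mul_pred (k : ℕ) : (k : ℂ) * ((k - 1 : ℕ) : ℂ) = (k : ℂ) * ((k : ℂ) - 1) := by
  rcases k with _ | k
  · simp
  · push_cast; ring

/-- **`d/dx [x^k e^{iπ(B−x)}] = (k x^{k−1} − iπ x^k) e^{iπ(B−x)}`** — `ddBase′` is the derivative of `ddBase`.
[cite: Zhang2022LandauSiegel, proof of Prop 7.1, (7.19)–(7.21); Lemma 5.2 p.10] -/
theorem hasDerivAt_ddBase (B : ℝ) (k : ℕ) (x : ℝ) : HasDerivAt (ddBase B k) (ddBase' B k x) x := by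
  -- the entire function Φ(z) = z^k · exp(iπ(B − z)) and its complex derivative, restricted to ℝ
  have hlin : HasDerivAt (fun z : ℂ => I * π * ((B : ℂ) - z)) (I * π * (-1)) (x : ℂ) :=
    ((hasDerivAt_id (x : ℂ)).const_sub (B : ℂ)).const_mul (I * π)
  have hE := hlin.cexp
  have hP := hasDerivAt_pow k (x : ℂ)
  have hΦ := (hP.fun_mul hE).comp_ofReal
  have e1 : ddBase B k = fun y : ℝ => (y : ℂ) ^ k * cexp (I * π * ((B : ℂ) - (y : ℂ))) := by
    funext y; simp only [ddBase, Complex.ofReal_sub]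
  have e2 : ddBase' B k x = (k : ℂ) * (x : ℂ) ^ (k - 1) * cexp (I * π * ((B : ℂ) - (x : ℂ)))
      + (x : ℂ) ^ k * (cexp (I * π * ((B : ℂ) - (x : ℂ))) * (I * π * (-1))) := by
    simp only [ddBase', Complex.ofReal_sub]; ring
  rw [e1, e2]
  exact hΦ

/-- **`d/dx [(k x^{k−1} − iπ x^k) e^{iπ(B−x)}] = (k(k−1)x^{k−2} − 2iπk x^{k−1} − π²x^k) e^{iπ(B−x)}`** — `ddBase″` is
the derivative of `ddBase′`. [cite: Zhang2022LandauSiegel, proof of Prop 7.1, (7.19)–(7.21); Lemma 5.2 p.10] -/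
theorem hasDerivAt_ddBase' (B : ℝ) (k : ℕ) (x : ℝ) : HasDerivAt (ddBase' B k) (ddBase'' B k x) x := by
  have hlin : HasDerivAt (fun z : ℂ => I * π * ((B : ℂ) - z)) (I * π * (-1)) (x : ℂ) :=
    ((hasDerivAt_id (x : ℂ)).const_sub (B : ℂ)).const_mul (I * π)
  have hE := hlin.cexp
  have hP1 := ((hasDerivAt_pow (k - 1) (x : ℂ)).const_mul (k : ℂ)).fun_sub
    ((hasDerivAt_pow k (x : ℂ)).const_mul (I * π))
  have hΨ := (hP1.fun_mul hE).comp_ofReal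
  have e1 : ddBase' B k = fun y : ℝ =>
      ((k : ℂ) * (y : ℂ) ^ (k - 1) - I * π * (y : ℂ) ^ k) * cexp (I * π * ((B : ℂ) - (y : ℂ))) := by
    funext y; simp only [ddBase', Complex.ofReal_sub]
  have e2 : ddBase'' B k x
      = ((k : ℂ) * (((k - 1 : ℕ) : ℂ) * (x : ℂ) ^ (k - 1 - 1)) - I * π * ((k : ℂ) * (x : ℂ) ^ (k - 1)))
          * cexp (I * π * ((B : ℂ) - (x : ℂ)))
        + ((k : ℂ) * (x : ℂ) ^ (k - 1) - I * π * (x : ℂ) ^ k)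
          * (cexp (I * π * ((B : ℂ) - (x : ℂ))) * (I * π * (-1))) := by
    have e3 : k - 1 - 1 = k - 2 := by omega
    rw [e3]
    simp only [ddBase'', Complex.ofReal_sub]
    have e4 := natCast_mul_pred k
    have hI : I * I = -1 := Complex.I_mul_I
    linear_combination (-((x : ℂ) ^ (k - 2) * cexp (I * π * ((B : ℂ) - (x : ℂ))))) * e4
      + (-((π : ℂ) ^ 2 * (x : ℂ) ^ k * cexp (I * π * ((B : ℂ) - (x : ℂ))))) * hI
  rw [e1, e2]
  exact hΨ

/-- `ddBase″` is jointly continuous in `(B, x)`. [cite: Zhang2022LandauSiegel, proof of Prop 7.1, (7.19)–(7.21); Lemma 5.2 p.10] -/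
theorem continuous_ddBase''₂ (k : ℕ) : Continuous fun p : ℝ × ℝ => ddBase'' p.1 k p.2 := by
  have h2 : Continuous fun p : ℝ × ℝ => ((p.2 : ℝ) : ℂ) := Complex.continuous_ofReal.comp continuous_snd
  have hBx : Continuous fun p : ℝ × ℝ => (((p.1 - p.2 : ℝ)) : ℂ) :=
    Complex.continuous_ofReal.comp (continuous_fst.sub continuous_snd)
  have hE : Continuous fun p : ℝ × ℝ => cexp (I * π * ((p.1 - p.2 : ℝ) : ℂ)) :=
    Complex.continuous_exp.comp (continuous_const.mul hBx)
  unfold ddBase''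
  exact (((continuous_const.mul (h2.pow _)).sub (continuous_const.mul (h2.pow _))).sub
    (continuous_const.mul (h2.pow _))).mul hE

/-- `ddBase″ B k` is continuous. [cite: Zhang2022LandauSiegel, proof of Prop 7.1, (7.19)–(7.21); Lemma 5.2 p.10] -/
theorem continuous_ddBase'' (B : ℝ) (k : ℕ) : Continuous (ddBase'' B k) := by
  have h2 : Continuous fun x : ℝ => ((x : ℝ) : ℂ) := Complex.continuous_ofReal
  have hE : Continuous fun x : ℝ => cexp (I * π * ((B - x : ℝ) : ℂ)) :=
    Complex.continuous_exp.comp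
      (continuous_const.mul (Complex.continuous_ofReal.comp (continuous_const.sub continuous_id)))
  unfold ddBase''
  exact (((continuous_const.mul (h2.pow _)).sub (continuous_const.mul (h2.pow _))).sub
    (continuous_const.mul (h2.pow _))).mul hE

/-- **The confluent moment `ddOf b k` is the Hermite–Genocchi simplex integral of `ddBase″`** (no case analysis).
[cite: Zhang2022LandauSiegel, proof of Prop 7.1, (7.19)–(7.21)] -/
theorem ddOf_eq_hg2 (b : Fin 3 → ℝ) (k : ℕ) :
    ddOf b k = hg2 (ddBase'' (shiftB b) k) (b 0) (b 1) (b 2) :=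
  dd2_eq_hg2 (hasDerivAt_ddBase _ _) (hasDerivAt_ddBase' _ _) (continuous_ddBase'' _ _) _ _ _

end NodeFunctions

/-! ### Part 3 — continuity of the confluent moments, the block entries and the block form -/

section Continuity

/-- **`b ↦ ddOf b k` is continuous on all of `Fin 3 → ℝ`** (across every coincidence of nodes).
[cite: Zhang2022LandauSiegel, proof of Prop 7.1, (7.19)–(7.21)] -/
theorem continuous_ddOf (k : ℕ) : Continuous fun b : Fin 3 → ℝ => ddOf b k := by
  have hF : Continuous (Function.uncurry fun (B : ℝ) (x : ℝ) => ddBase'' B k x) := continuous_ddBase''₂ k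
  have hq : Continuous fun b : Fin 3 → ℝ => (shiftB b, b 0, b 1, b 2) := by
    unfold shiftB; fun_prop
  have := (continuous_hg2_param hF).comp hq
  refine this.congr fun b => ?_
  simp only [Function.comp_apply, ddOf_eq_hg2]

/-- `b ↦ m₀(b)` is continuous. [cite: Zhang2022LandauSiegel, proof of Prop 7.1, (7.19)–(7.21)] -/
theorem continuous_ddM0 : Continuous ddM0 := continuous_ddOf 1
/-- `b ↦ m_b(b)` is continuous. [cite: Zhang2022LandauSiegel, §8 (8.13)–(8.18)] -/
theorem continuous_ddMb : Continuous ddMb := continuous_ddOf 2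
/-- `b ↦ m_s(b)` is continuous. [cite: Zhang2022LandauSiegel, §8 (8.13)–(8.18)] -/
theorem continuous_ddMs : Continuous ddMs := by
  unfold ddMs shiftB
  have h0 := continuous_ddM0; have hb := continuous_ddMb
  fun_prop
/-- `b ↦ m_n(b)` is continuous. [cite: Zhang2022LandauSiegel, §8 (8.13)–(8.18)] -/
theorem continuous_ddMn : Continuous ddMn := by
  unfold ddMn
  have h0 := continuous_ddOf 0
  fun_prop
/-- `b ↦ m_bs(b)` is continuous. [cite: Zhang2022LandauSiegel, §8 (8.13)–(8.18)] -/
theorem continuous_ddMbs : Continuous ddMbs := by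
  unfold ddMbs shiftB
  have hb := continuous_ddMb; have h3 := continuous_ddOf 3
  fun_prop
/-- `b ↦ m_bn(b)` is continuous. [cite: Zhang2022LandauSiegel, §8 (8.13)–(8.18)] -/
theorem continuous_ddMbn : Continuous ddMbn := by
  unfold ddMbn
  have h0 := continuous_ddM0
  fun_prop

/-- `MformOf` is continuous in its six moments (it is affine-multilinear in them).
[cite: Zhang2022LandauSiegel, Prop 7.1 with (8.11)–(8.23), pp.44–50] -/
theorem continuous_mformOf (g g' h h' : ℝ → ℂ) :
    Continuous fun m : ℂ × ℂ × ℂ × ℂ × ℂ × ℂ =>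
      MformOf m.1 m.2.1 m.2.2.1 m.2.2.2.1 m.2.2.2.2.1 m.2.2.2.2.2 g g' h h' := by
  have h0 : Continuous fun m : ℂ × ℂ × ℂ × ℂ × ℂ × ℂ => m.1 := continuous_fst
  have h1 : Continuous fun m : ℂ × ℂ × ℂ × ℂ × ℂ × ℂ => m.2.1 := continuous_fst.comp continuous_snd
  have h2 : Continuous fun m : ℂ × ℂ × ℂ × ℂ × ℂ × ℂ => m.2.2.1 :=
    continuous_fst.comp (continuous_snd.comp continuous_snd)
  have h3 : Continuous fun m : ℂ × ℂ × ℂ × ℂ × ℂ × ℂ => m.2.2.2.1 :=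
    continuous_fst.comp (continuous_snd.comp (continuous_snd.comp continuous_snd))
  have h4 : Continuous fun m : ℂ × ℂ × ℂ × ℂ × ℂ × ℂ => m.2.2.2.2.1 :=
    continuous_fst.comp (continuous_snd.comp (continuous_snd.comp (continuous_snd.comp continuous_snd)))
  have h5 : Continuous fun m : ℂ × ℂ × ℂ × ℂ × ℂ × ℂ => m.2.2.2.2.2 :=
    continuous_snd.comp (continuous_snd.comp (continuous_snd.comp (continuous_snd.comp continuous_snd)))
  unfold MformOf
  exact continuous_const.mul
    ((((((h0.mul continuous_const).sub ((continuous_const.mul h1).mul continuous_const)).add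
      ((continuous_const.mul h3).mul continuous_const)).add
      ((continuous_const.mul (h2.add h4)).mul continuous_const)).sub
      ((continuous_const.mul h2).mul continuous_const)).add
      ((continuous_const.mul h5).mul continuous_const))

/-- **`b ↦ MformDD b g h` is continuous** for fixed profiles. [cite: Zhang2022LandauSiegel, Prop 7.1 with (8.11)–(8.23), pp.44–50] -/
theorem continuous_mformDD (g g' h h' : ℝ → ℂ) : Continuous fun b : Fin 3 → ℝ => MformDD b g g' h h' := by
  have hm : Continuous fun b : Fin 3 → ℝ => (ddM0 b, ddMs b, ddMn b, ddMb b, ddMbs b, ddMbn b) := by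
    have := continuous_ddM0; have := continuous_ddMs; have := continuous_ddMn
    have := continuous_ddMb; have := continuous_ddMbs; have := continuous_ddMbn
    fun_prop
  refine ((continuous_mformOf g g' h h').comp hm).congr fun b => ?_
  simp only [Function.comp_apply, MformDD]

/-- **`b ↦ P^{dd}_b(g,h)` is continuous** for fixed profiles. [cite: Zhang2022LandauSiegel, Prop 7.1 p.44, (8.11)–(8.12)] -/
theorem continuous_formDetPolarDD (g g' h h' : ℝ → ℂ) :
    Continuous fun b : Fin 3 → ℝ => FormDetPolarDD b g g' h h' := by
  unfold FormDetPolarDD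
  exact (continuous_mformDD g g' h h').add (Complex.continuous_conj.comp (continuous_mformDD h h' g g'))

/-- **`b ↦ FormDetDD b g` is continuous** for a fixed profile. [cite: Zhang2022LandauSiegel, proof of Prop 7.1, (7.19)–(7.21)] -/
theorem continuous_formDetDD (g g' : ℝ → ℂ) : Continuous fun b : Fin 3 → ℝ => FormDetDD b g g' :=
  (Complex.continuous_re.comp (continuous_formDetPolarDD g g' g g')).congr fun b =>
    formDetPolarDD_self_re b g g'

/-- The triple `(a, b_j, b_l)` depends continuously on `(a, b)`. [folklore] -/
private theorem continuous_triple {K : ℕ} (j l : Fin K) :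
    Continuous fun p : ℝ × (Fin K → ℝ) => (![p.1, p.2 j, p.2 l] : Fin 3 → ℝ) := by
  refine continuous_pi fun i => ?_
  fin_cases i
  · exact continuous_fst
  · exact (continuous_apply j).comp continuous_snd
  · exact (continuous_apply l).comp continuous_snd

/-- **`(a, b) ↦ m(a;b;h)` is continuous** on `ℝ × (Fin K → ℝ)` for a fixed profile vector.
[cite: Zhang2022LandauSiegel, Prop 7.1 p.44, (8.11)–(8.12)] -/
theorem continuous_entangledMain {K : ℕ} (h h' : Fin K → ℝ → ℂ) :
    Continuous fun p : ℝ × (Fin K → ℝ) => entangledMain p.1 p.2 h h' := by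
  unfold entangledMain
  refine continuous_finsetSum _ fun j _ => continuous_finsetSum _ fun l _ => ?_
  exact (continuous_formDetPolarDD (h j) (h' j) (h l) (h' l)).comp (continuous_triple j l)

end Continuity

/-! ### Part 4 — the cone row is stable under closure of the anchor set and of the shift box -/

section Closure

/-- **The set of PSD members `{(a, b) | ConePSD a b}` is CLOSED** in `ℝ × (Fin K → ℝ)` (an intersection of closed
half-spaces `0 ≤ Re m(a;b;h)` over the profile vectors). [cite: Zhang2022LandauSiegel, Prop 7.1 p.44, (7.2)] -/
theorem isClosed_setOf_conePSD (K : ℕ) : IsClosed {p : ℝ × (Fin K → ℝ) | ConePSD p.1 p.2} := by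
  have e : {p : ℝ × (Fin K → ℝ) | ConePSD p.1 p.2}
      = ⋂ (h : Fin K → ℝ → ℂ), ⋂ (h' : Fin K → ℝ → ℂ), ⋂ (_ : ∀ j, KinkedProfile (h j) (h' j)),
          ⋂ (_ : ∀ j, h j 1 = 0), {p : ℝ × (Fin K → ℝ) | 0 ≤ (entangledMain p.1 p.2 h h').re} := by
    ext p
    simp only [ConePSD, mem_setOf_eq, mem_iInter]
  rw [e]
  refine isClosed_iInter fun h => isClosed_iInter fun h' => isClosed_iInter fun _ =>
    isClosed_iInter fun _ => ?_
  exact isClosed_le continuous_const (Complex.continuous_re.comp (continuous_entangledMain h h'))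

/-- **Closure stability of the cone row**: `EdetCone A B → EdetCone (closure A) (closure B)` — PSD on every finite
palette with anchors in `A` and shifts in `B` propagates to anchors in `closure A` and shifts in `closure B`
(continuity of the block form + closedness of `[0, ∞)`). [cite: Zhang2022LandauSiegel, Prop 7.1 p.44, (7.2)] -/
theorem EdetCone.of_closure {A B : Set ℝ} (hE : EdetCone A B) : EdetCone (closure A) (closure B) := by
  intro K a ha b hb
  have hsub : A ×ˢ (Set.univ.pi fun _ : Fin K => B) ⊆ {p : ℝ × (Fin K → ℝ) | ConePSD p.1 p.2} := by
    rintro ⟨a', b'⟩ ⟨ha', hb'⟩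
    exact hE K a' ha' b' fun j => hb' j (mem_univ j)
  have hmem : (a, b) ∈ closure (A ×ˢ (Set.univ.pi fun _ : Fin K => B)) := by
    rw [closure_prod_eq, closure_pi_set]
    exact Set.mk_mem_prod ha (Set.mem_univ_pi.2 hb)
  have key := (isClosed_setOf_conePSD K).closure_subset_iff.2 hsub hmem
  simpa only [mem_setOf_eq] using key

/-- **A dense anchor set and a dense shift set suffice for head 1 of E-102**: if `(0,1) ⊆ closure A` and
`(0,5) ⊆ closure B` then `EdetCone A B → EdetCone (Set.Ioo 0 1) (Set.Ioo 0 5)`.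
[cite: Zhang2022LandauSiegel, Prop 7.1 p.44, (7.2)] -/
theorem edetCone_unit_of_dense {A B : Set ℝ} (hA : Ioo (0:ℝ) 1 ⊆ closure A) (hB : Ioo (0:ℝ) 5 ⊆ closure B)
    (hE : EdetCone A B) : EdetCone (Ioo 0 1) (Ioo 0 5) :=
  hE.of_closure.mono hA hB

/-- In particular **rational anchors and rational shifts suffice**: the cone row on
`(ℚ ∩ (0,1)) × (ℚ ∩ (0,5))`-palettes implies the row of record `EdetCone (Set.Ioo 0 1) (Set.Ioo 0 5)`.
[cite: Zhang2022LandauSiegel, Prop 7.1 p.44, (7.2)] -/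
theorem edetCone_unit_of_rat
    (hE : EdetCone (Ioo (0:ℝ) 1 ∩ range ((↑) : ℚ → ℝ)) (Ioo (0:ℝ) 5 ∩ range ((↑) : ℚ → ℝ))) :
    EdetCone (Ioo 0 1) (Ioo 0 5) :=
  edetCone_unit_of_dense (Rat.denseRange_cast.open_subset_closure_inter isOpen_Ioo)
    (Rat.denseRange_cast.open_subset_closure_inter isOpen_Ioo) hE

/-- **Head-2 analogue on the distinct-node locus**: the set of triples on which the confluent recipe form is `≥ 0`
on one-sided kinked profiles is closed, so non-negativity of `FormDetDD` on a set `D` of triples gives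
`Det.FormDetPSD (Det.shiftRecipe b)` at every DISTINCT triple `b ∈ closure D` (`formDetDD_eq_formDet`).
[cite: Zhang2022LandauSiegel, proof of Prop 7.1, (7.19)–(7.21); §8 (8.11)–(8.23)] -/
theorem formDetPSD_of_closure {D : Set (Fin 3 → ℝ)}
    (hD : ∀ c ∈ D, ∀ g g' : ℝ → ℂ, KinkedProfile g g' → g 1 = 0 → 0 ≤ FormDetDD c g g')
    {b : Fin 3 → ℝ} (hb : b ∈ closure D) (hinj : Function.Injective b) :
    FormDetPSD (shiftRecipe b) := by
  intro g g' hg hg1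
  have hclosed : IsClosed {c : Fin 3 → ℝ | 0 ≤ FormDetDD c g g'} :=
    isClosed_le continuous_const (continuous_formDetDD g g')
  have hsub : D ⊆ {c : Fin 3 → ℝ | 0 ≤ FormDetDD c g g'} := fun c hc => hD c hc g g' hg hg1
  have h0 : 0 ≤ FormDetDD b g g' := hclosed.closure_subset_iff.2 hsub hb
  rwa [formDetDD_eq_formDet hinj hg hg1] at h0

/-- Fixed-anchor version: `{b | ConePSD a b}` is closed in `Fin K → ℝ`. [cite: Zhang2022LandauSiegel, Prop 7.1 p.44, (7.2)] -/
theorem isClosed_setOf_conePSD_right (a : ℝ) (K : ℕ) : IsClosed {b : Fin K → ℝ | ConePSD a b} :=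
  (isClosed_setOf_conePSD K).preimage (Continuous.prodMk continuous_const continuous_id)

/-- **`conePSD_of_closure`**: PSD on a set `S` of palettes (fixed anchor) gives PSD on `closure S`.
[cite: Zhang2022LandauSiegel, Prop 7.1 p.44, (7.2)] -/
theorem conePSD_of_closure {a : ℝ} {K : ℕ} {S : Set (Fin K → ℝ)} (hS : ∀ c ∈ S, ConePSD a c)
    {b : Fin K → ℝ} (hb : b ∈ closure S) : ConePSD a b :=
  (isClosed_setOf_conePSD_right a K).closure_subset_iff.2 hS hb

/-- **`conePSD_of_dense`** (E102-DISCHARGE v1.4 piece A3, as named there): PSD on a DENSE set of palettes (fixed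
anchor, fixed size `K`) gives PSD on every palette. [cite: Zhang2022LandauSiegel, Prop 7.1 p.44, (7.2)] -/
theorem conePSD_of_dense {a : ℝ} {K : ℕ} {S : Set (Fin K → ℝ)} (hS : ∀ c ∈ S, ConePSD a c) (hd : Dense S)
    (b : Fin K → ℝ) : ConePSD a b :=
  conePSD_of_closure hS (hd b)

end Closure

/-! ### Part 5 — block level: an identity proved at pairwise-distinct nodes extends to confluent nodes -/

section BlockLevel

/-- **The block entry is jointly continuous in its two shift nodes** (anchor and profiles fixed), confluence
included. [cite: Zhang2022LandauSiegel, Prop 7.1 p.44, (8.11)–(8.12)] -/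
theorem continuous_formDetPolarDD_nodes (a : ℝ) (g g' h h' : ℝ → ℂ) :
    Continuous fun p : ℝ × ℝ => FormDetPolarDD ![a, p.1, p.2] g g' h h' := by
  have ht : Continuous fun p : ℝ × ℝ => (![a, p.1, p.2] : Fin 3 → ℝ) := by
    refine continuous_pi fun i => ?_
    fin_cases i
    · exact continuous_const
    · exact continuous_fst
    · exact continuous_snd
  exact (continuous_formDetPolarDD g g' h h').comp ht

/-- `u + c/(n+1) ≠ v` for all large `n` (any reals `u, v`, any `c ≠ 0`). [folklore] -/
private theorem eventually_add_div_ne (u v c : ℝ) (hc : c ≠ 0) :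
    ∀ᶠ n : ℕ in atTop, u + c / ((n : ℝ) + 1) ≠ v := by
  have hlim : Tendsto (fun n : ℕ => u + c / ((n : ℝ) + 1)) atTop (𝓝 u) := by
    have h1 : Tendsto (fun n : ℕ => c / ((n : ℝ) + 1)) atTop (𝓝 0) :=
      tendsto_const_nhds.div_atTop (tendsto_natCast_atTop_atTop.atTop_add tendsto_const_nhds)
    simpa using tendsto_const_nhds.add h1
  by_cases huv : u = v
  · subst huv
    refine Eventually.of_forall fun n => ?_
    have hpos : (0 : ℝ) < (n : ℝ) + 1 := by positivity
    have : c / ((n : ℝ) + 1) ≠ 0 := div_ne_zero hc hpos.ne'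
    intro h
    exact this (by linarith)
  · exact hlim.eventually_ne huv

/-- **The pairwise-distinct node pairs are dense**: for a fixed anchor `a`, `{(x, y) | a ≠ x, x ≠ y, a ≠ y}` is dense
in `ℝ²` (approach `(x, y)` along `(x + 1/(n+1), y + 2/(n+1))`).
[cite: deBoor2005DividedDifferences, §Continuity and smoothness, Proposition (continuity of the divided difference in its sites)] -/
theorem dense_setOf_pairwise_ne (a : ℝ) : Dense {p : ℝ × ℝ | a ≠ p.1 ∧ p.1 ≠ p.2 ∧ a ≠ p.2} := by
  intro p
  obtain ⟨x, y⟩ := p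
  refine mem_closure_of_tendsto (f := fun n : ℕ => (x + 1 / ((n : ℝ) + 1), y + 2 / ((n : ℝ) + 1)))
    (b := atTop) ?_ ?_
  · have h1 : Tendsto (fun n : ℕ => 1 / ((n : ℝ) + 1)) atTop (𝓝 0) :=
      tendsto_const_nhds.div_atTop (tendsto_natCast_atTop_atTop.atTop_add tendsto_const_nhds)
    have h2 : Tendsto (fun n : ℕ => 2 / ((n : ℝ) + 1)) atTop (𝓝 0) :=
      tendsto_const_nhds.div_atTop (tendsto_natCast_atTop_atTop.atTop_add tendsto_const_nhds)
    have hx : Tendsto (fun n : ℕ => x + 1 / ((n : ℝ) + 1)) atTop (𝓝 x) := by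
      simpa using tendsto_const_nhds.add h1
    have hy : Tendsto (fun n : ℕ => y + 2 / ((n : ℝ) + 1)) atTop (𝓝 y) := by
      simpa using tendsto_const_nhds.add h2
    exact hx.prodMk_nhds hy
  · -- eventually all three inequalities hold
    have e1 := eventually_add_div_ne x a 1 one_ne_zero            -- x + 1/(n+1) ≠ a
    have e2 := eventually_add_div_ne y a 2 two_ne_zero            -- y + 2/(n+1) ≠ a
    have e3' : ∀ᶠ n : ℕ in atTop, x + 1 / ((n : ℝ) + 1) ≠ y + 2 / ((n : ℝ) + 1) := by
      have := eventually_add_div_ne y x 1 one_ne_zero             -- y + 1/(n+1) ≠ x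
      refine this.mono fun n hn h => hn ?_
      have e2' : (2 : ℝ) / ((n : ℝ) + 1) = 2 * (1 / ((n : ℝ) + 1)) := by ring
      linarith
    refine (e1.and (e2.and e3')).mono fun n hn => ?_
    simp only [mem_setOf_eq]
    exact ⟨fun h => hn.1 h.symm, hn.2.2, fun h => hn.2.1 h.symm⟩

/-- **Extension from distinct to confluent nodes**: two functions of the node pair that are continuous on `ℝ²`
and agree whenever `a, x, y` are pairwise distinct agree everywhere (in particular on the confluent diagonal
`y = x` and at `x = a`). The composition step of E102-DISCHARGE v1.4 LINE A uses it with
`f = fun (x,y) => FormDetPolarDD ![a,x,y] h h′ g g′` (`continuous_formDetPolarDD_nodes`); de Boor: «it is usually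
sufficient to check a proposed divided difference identity by checking it only for pairwise distinct arguments».
[cite: deBoor2005DividedDifferences, §Continuity and smoothness, Proposition (continuity of the divided difference in its sites)] -/
theorem eq_of_eqOn_pairwise_ne {E : Type*} [TopologicalSpace E] [T2Space E] (a : ℝ) {f g : ℝ × ℝ → E}
    (hf : Continuous f) (hg : Continuous g)
    (h : ∀ x y : ℝ, a ≠ x → x ≠ y → a ≠ y → f (x, y) = g (x, y)) : f = g := by
  have heq : EqOn f g {p : ℝ × ℝ | a ≠ p.1 ∧ p.1 ≠ p.2 ∧ a ≠ p.2} := by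
    rintro ⟨x, y⟩ ⟨h1, h2, h3⟩
    exact h x y h1 h2 h3
  have hcl := heq.closure hf hg
  rw [(dense_setOf_pairwise_ne a).closure_eq] at hcl
  exact funext fun p => hcl (mem_univ p)

end BlockLevel


end Det

end Literature.NumberTheory.LFunctions.Zhang2022
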